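import Literature.NumberTheory.Weil1964.RealWeilIndexMaslov
import Literature.LinearAlgebra.QuadraticForm.MetaplecticDoubleCoverOrdered
import HarnessLib

/-!
# At the real place, LV's cocycle `c_ℓ` is the inverse of the Weil index of Kashiwara's form
# ([LionVergne1980, 1.6.11 with A.9]; [Weil1964, n° 26])

Topic `NumberTheory/Weil1964`; namespace `Literature.NumberTheory.Weil1964`. KERNEL mathematics only (theorems; no
definition, no named fact, no `axiom`, no `sorry`). Junction of `RealWeilIndexMaslov.lean` (the Weil index of the
second-degree character of Kashiwara's form `Q(x₁,x₂,x₃) = B(x₁,x₂) + B(x₂,x₃) + B(x₃,x₁)` on a real vector space is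
`e^{iπτ(ℓ₁,ℓ₂,ℓ₃)/4}`, `τ` the Maslov index — Weil's normalisation) with
`LinearAlgebra/QuadraticForm/MetaplecticDoubleCoverOrdered.lean` (LV's `c_ℓ(g₁,g₂) = e^{−iπ/4 τ(ℓ,g₁ℓ,g₁g₂ℓ)}`, the
Mackey cocycle `c_ℓ⁻¹`, the metaplectic group over an ordered field).

[LionVergne1980, §1.6.11] (`k = ℝ`): "`c_ℓ(g₁,g₂) = e^{−iπ/4 τ(ℓ,g₁ℓ,g₁g₂ℓ)}`"; [LionVergne1980, A.9] (local field,
`γ` the Weil index on the Witt group): "`R_ℓ(g₁g₂) = c_ℓ(g₁,g₂) R_ℓ(g₁) R_ℓ(g₂)` with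
`c_ℓ(g₁,g₂) = γ(τ(ℓ, g₁ℓ, g₁g₂ℓ))⁻¹`".  At the real place both descriptions agree: for a real symplectic space with
Lagrangian `ℓ` and `g₁, g₂ ∈ Sp(B)`,

* `coe_mackeyCocycle`: the tree's Mackey cocycle `c_ℓ⁻¹` is `e^{+iπτ_ℓ(g₁,g₂)/4}` as a complex number;
* **`mackeyCocycle_eq_realWeilIndexSymm`**: `c_ℓ(g₁,g₂)⁻¹ = γ(Q_{ℓ, g₁ℓ, g₁g₂ℓ})`, the Weil index (tree
  `realWeilIndexSymm`, Weil's `γ(f)` of [Weil1964, n° 26]) of Kashiwara's form of the triple `(ℓ, g₁ℓ, g₁g₂ℓ)` read in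
  ANY basis — the real-place case of A.9, matching the non-archimedean `lerayCocycle = γ(τ_W(ℓ, g₁ℓ, g₁g₂ℓ))` of
  `LocalLerayCocycle.lean` / `LocalMetaplecticDoubleCover.lean`;
* `lvCocycle_eq_inv_realWeilIndexSymm`: `c_ℓ(g₁,g₂) = γ(Q_{ℓ, g₁ℓ, g₁g₂ℓ})⁻¹` (1.6.11 = A.9 at `k = ℝ`).

NOT claimed: that `c_ℓ` is the multiplier of the Schrödinger-model Weil representation `R_ℓ` (1.6.11's derivation via
the operators `𝓕_{ℓ,ℓ'}`, analytic).

## References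

* [LionVergne1980] G. Lion, M. Vergne, *The Weil representation, Maslov index and Theta series*, PM 6, Birkhäuser
  (1980), Part I §1.6.11 (p. 31); Appendix A.9 (p. 59).
* [Weil1964] A. Weil, *Sur certains groupes d'opérateurs unitaires*, Acta Math. 111 (1964), Chap. II n° 26, p. 174.
-/

set_option autoImplicit false

noncomputable section

open Complex
open Literature.LinearAlgebra.QuadraticForm
open Literature.RepresentationTheory.HeisenbergGroup.Heisenberg.PseudoSymplectic (isometries)

namespace Literature.NumberTheory.Weil1964

variable {V : Type*} [AddCommGroup V] [Module ℝ V] [FiniteDimensional ℝ V]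
variable {ι : Type*} [Fintype ι] [DecidableEq ι]
variable (D : SymplecticLagrangian ℝ V)

/-- the Mackey cocycle `c_ℓ⁻¹` as a complex number: `e^{iπ τ_ℓ(g₁,g₂)/4}`. [cite: LionVergne1980, §1.6.11–1.6.12] -/
theorem coe_mackeyCocycle (g₁ g₂ : isometries D.form) :
    ((D.mackeyCocycle g₁ g₂ : ℂˣ) : ℂ) =
      cexp (((Real.pi / 4 * (maslovCocycle D.form D.plane (g₁ : V ≃ₗ[ℝ] V) (g₂ : V ≃ₗ[ℝ] V) : ℝ) : ℝ) : ℂ) * I) := by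
  rw [SymplecticLagrangian.mackeyCocycle_apply, Units.val_zpow_eq_zpow_val, Metaplectic.coe_zeta8, ← Complex.exp_int_mul]
  congr 1
  push_cast
  ring

/-- **[LionVergne1980, A.9 at `k = ℝ`]: `c_ℓ(g₁,g₂)⁻¹ = γ(Q_{ℓ, g₁ℓ, g₁g₂ℓ})`** — the Mackey cocycle of the tree's
`MetaplecticDoubleCoverOrdered` equals the real Weil index (Weil's `γ(f)`, tree `realWeilIndexSymm`) of the
second-degree character of Kashiwara's form of `(ℓ, g₁ℓ, g₁g₂ℓ)`, computed from its Gram matrix in any basis `b`.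
[cite: LionVergne1980, Appendix A.9; §1.6.11; Weil1964, Chap. II n° 26, p. 174] -/
theorem mackeyCocycle_eq_realWeilIndexSymm (g₁ g₂ : isometries D.form)
    (b : Module.Basis ι ℝ
      (↥D.plane × ↥(D.plane.map ((g₁ : V ≃ₗ[ℝ] V) : V →ₗ[ℝ] V)) ×
        ↥(D.plane.map ((((g₁ : V ≃ₗ[ℝ] V) * (g₂ : V ≃ₗ[ℝ] V) : V ≃ₗ[ℝ] V)) : V →ₗ[ℝ] V))))
    (hS : (QuadraticForm.toMatrix'
      ((kashiwaraForm D.form D.plane (D.plane.map ((g₁ : V ≃ₗ[ℝ] V) : V →ₗ[ℝ] V))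
        (D.plane.map ((((g₁ : V ≃ₗ[ℝ] V) * (g₂ : V ≃ₗ[ℝ] V) : V ≃ₗ[ℝ] V)) : V →ₗ[ℝ] V))).basisRepr b)).IsHermitian) :
    ((D.mackeyCocycle g₁ g₂ : ℂˣ) : ℂ) = realWeilIndexSymm hS := by
  rw [coe_mackeyCocycle, realWeilIndexSymm_kashiwaraForm, maslovCocycle_eq]

/-- **[LionVergne1980, 1.6.11 = A.9 at `k = ℝ`]: `c_ℓ(g₁,g₂) = e^{−iπτ/4} = γ(Q_{ℓ, g₁ℓ, g₁g₂ℓ})⁻¹`.**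
[cite: LionVergne1980, §1.6.11; Appendix A.9; Weil1964, Chap. II n° 26] -/
theorem lvCocycle_eq_inv_realWeilIndexSymm (g₁ g₂ : isometries D.form)
    (b : Module.Basis ι ℝ
      (↥D.plane × ↥(D.plane.map ((g₁ : V ≃ₗ[ℝ] V) : V →ₗ[ℝ] V)) ×
        ↥(D.plane.map ((((g₁ : V ≃ₗ[ℝ] V) * (g₂ : V ≃ₗ[ℝ] V) : V ≃ₗ[ℝ] V)) : V →ₗ[ℝ] V))))
    (hS : (QuadraticForm.toMatrix'
      ((kashiwaraForm D.form D.plane (D.plane.map ((g₁ : V ≃ₗ[ℝ] V) : V →ₗ[ℝ] V))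
        (D.plane.map ((((g₁ : V ≃ₗ[ℝ] V) * (g₂ : V ≃ₗ[ℝ] V) : V ≃ₗ[ℝ] V)) : V →ₗ[ℝ] V))).basisRepr b)).IsHermitian) :
    ((D.lvCocycle g₁ g₂ : ℂˣ) : ℂ) = (realWeilIndexSymm hS)⁻¹ := by
  rw [← mackeyCocycle_eq_realWeilIndexSymm D g₁ g₂ b hS, SymplecticLagrangian.mackeyCocycle_eq_lvCocycle_inv,
    Units.val_inv_eq_inv_val, inv_inv]

/-- hypothesis-free form: in any basis the Gram matrix of Kashiwara's form of `(ℓ, g₁ℓ, g₁g₂ℓ)` is symmetric and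
`c_ℓ(g₁,g₂)⁻¹` is its Weil index. [cite: LionVergne1980, Appendix A.9; §1.6.11] -/
theorem exists_mackeyCocycle_eq_realWeilIndexSymm (g₁ g₂ : isometries D.form)
    (b : Module.Basis ι ℝ
      (↥D.plane × ↥(D.plane.map ((g₁ : V ≃ₗ[ℝ] V) : V →ₗ[ℝ] V)) ×
        ↥(D.plane.map ((((g₁ : V ≃ₗ[ℝ] V) * (g₂ : V ≃ₗ[ℝ] V) : V ≃ₗ[ℝ] V)) : V →ₗ[ℝ] V)))) :
    ∃ hS : (QuadraticForm.toMatrix'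
      ((kashiwaraForm D.form D.plane (D.plane.map ((g₁ : V ≃ₗ[ℝ] V) : V →ₗ[ℝ] V))
        (D.plane.map ((((g₁ : V ≃ₗ[ℝ] V) * (g₂ : V ≃ₗ[ℝ] V) : V ≃ₗ[ℝ] V)) : V →ₗ[ℝ] V))).basisRepr b)).IsHermitian,
      ((D.mackeyCocycle g₁ g₂ : ℂˣ) : ℂ) = realWeilIndexSymm hS :=
  ⟨Matrix.isHermitian_iff_isSymm.2 (QuadraticForm.isSymm_toMatrix' _), mackeyCocycle_eq_realWeilIndexSymm D g₁ g₂ b _⟩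

end Literature.NumberTheory.Weil1964
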